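import Summits.CriticalPhenomena.CardyFormulaZ2.Theorems.EdgeCoherence.Negative.CornerObservableRigidity
import Literature.Probability.LatticeModels.UnitDiscDiscretisation
import Literature.Probability.LatticeModels.MedialInterfaceProofs
import Literature.Probability.LatticeModels.FermionicObservableSums
import Literature.Probability.LatticeModels.DiscreteFaceBoundary
import Literature.Probability.LatticeModels.DobrushinDiscretisation
import Literature.Probability.Percolation.InterfaceScalingLimitDiscretised
import HarnessLib

/-!
# An ORIENTED certified discretisation family: the clockwise unit disc and the arc-swapped tilted data

Sub-problem `CriticalPhenomena/CardyFormulaZ2`; crux `CardyRigidity` (stmt-CriticalPhenomena-0746), line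
`crossing_martingale` (skeleton `Cruxes/CardyRigidity/Lines/crossing_martingale.lean`).

The percolation half of the line conditions on prefixes of the NATIVE medial exploration
(`LatticeModels.medialExploration`, filtration `explorationFiltration`), which starts at the `A`–`B`
edge `e_a` singled out by the start-corner parity (`DiscreteDobrushin.IsStartCorner`), while the
interface `Percolation.bondInterfaceIn D E ω` is RE-ORIENTED by the endpoint rule `orientCurve D` to run
from `a = D.pt 0` to `b = D.pt 1`.  For the counter-clockwise unit disc `DobrushinDomain.unitDisc` with
the certified tilted data `UnitDiscDiscretisation.discData` the native exploration starts near `b = -1`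
(start vertex `(-M, 0)`), so the Loewner description from `a` and the exploration filtration do not
match.  This file provides ONE Dobrushin domain with a certified discretisation family whose native
exploration starts at `a`:

* `unitDiscCW` — the unit disc with CLOCKWISE boundary loop `t ↦ exp(-2πit)`, marked at `1` and `-1`
  (parameters `0`, `1/2`); its arc `0` is the LOWER closed half circle (`= unitDisc.arc 1`) and its arc
  `1` the upper one (`= unitDisc.arc 0`);
* `discDataSwap δ = ⟨𝔻, δ, tiltLo δ, tiltUp δ⟩` — the certified tilted data of
  `Literature/Probability/LatticeModels/UnitDiscDiscretisation.lean` with the two arcs EXCHANGED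
  (wired arc = tilted lower arc); admissible for `0 < δ < 1/2`, start corner at `(M, 0)` with class
  `1` (both adapted from the disprover's workfile `Cruxes/EdgeCoherence/Disproof.lean`, §3d, where they
  were first written down), `A`–`B` edges unchanged;
* `zdDiscretisationFamily_discDataSwap : ZdDiscretisationFamily unitDiscCW discDataSwap`;
* `bondInterfaceIn_discDataSwap` — for `0 < δ < 1/2` the interface of `discDataSwap δ` in `unitDiscCW`
  is the class of the native exploration polyline itself (no time reversal): its first vertex is the
  midpoint `(δM, δ/2)` of `e_R`, nearer to `a = 1` than to `b = -1`.
-/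

noncomputable section

open Filter Topology Metric Set Complex
open Literature.Probability Literature.Probability.RandomPlanarGeometry
  Literature.Probability.LatticeModels Literature.Probability.LatticeModels.UnitDiscDiscretisation
open Literature.Probability.LatticeModels.DiscreteDobrushin (startCorner isStartCorner_startCorner
  existsUnique_startCorner medialExploration_eq_explorationList)
open Summit.CriticalPhenomena.CardyFormulaZ2.Theorems.EdgeCoherence.Negative (discDataSwap discDataSwap_Ω
  discDataSwap_δ zdArcA_swap zdArcB_swap isInnerFace_swap zdBoundary_swap zdABEdges_swap
  isZdAdmissible_discDataSwap isStartCorner_discDataSwap)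

namespace Summit.CriticalPhenomena.CardyFormulaZ2.Cruxes.CardyRigidity.CrossingMartingale
-- buildfix lane 2026-08-20: namespace-local alias(es) so that short names made ambiguous by the
-- 2026-08-15 Literature migration (old home vs re-exported new home, both in the import cone) resolve,
-- as in the accepted build, to the OLD home `Literature.Probability.Percolation`. No declaration text changes.
export Literature.Probability (Percolation.bondInterfaceIn Percolation.bondInterfaceIn_apply Percolation.orientCurve_of_le)

namespace OrientedDisc

/-! ### The clockwise unit disc -/

/-- `exp(-iθ)` is the complex conjugate of `exp(iθ)` on the unit circle. [folklore] -/
theorem circleMap_neg (θ : ℝ) : circleMap 0 1 (-θ) = starRingEnd ℂ (circleMap 0 1 θ) := by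
  rw [circleMap_zero_one, circleMap_zero_one, ← Complex.exp_conj, map_mul, Complex.conj_ofReal,
    Complex.conj_I, Complex.ofReal_neg]
  ring_nf

/-- **The clockwise unit disc** `(𝔻; 1, -1)`: the open unit ball with the clockwise boundary loop
`t ↦ exp(-2πit)` and marks at parameters `0`, `1/2`. [folklore] -/
def unitDiscCW : DobrushinDomain where
  carrier := ball 0 1
  boundary t := circleMap 0 1 (2 * Real.pi * -t)
  isOpen := isOpen_ball
  isBounded := isBounded_ball
  isConnected := ((convex_ball (0 : ℂ) 1).isPathConnected (by simp)).isConnected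
  continuous_boundary := (continuous_circleMap 0 1).comp (continuous_const.mul continuous_neg)
  periodic_boundary t := by
    simp only
    rw [show 2 * Real.pi * -(t + 1) = 2 * Real.pi * -t - 2 * Real.pi by ring]
    exact (periodic_circleMap 0 1).sub_eq _
  injOn_boundary := by
    intro s hs t ht h
    have h' : circleMap 0 1 (2 * Real.pi * s) = circleMap 0 1 (2 * Real.pi * t) := by
      have hs' : circleMap 0 1 (2 * Real.pi * -s) = starRingEnd ℂ (circleMap 0 1 (2 * Real.pi * s)) := by
        rw [← circleMap_neg]; ring_nf
      have ht' : circleMap 0 1 (2 * Real.pi * -t) = starRingEnd ℂ (circleMap 0 1 (2 * Real.pi * t)) := by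
        rw [← circleMap_neg]; ring_nf
      simp only at h
      rw [hs', ht'] at h
      exact (starRingEnd ℂ).injective h
    exact JordanDomain.unitDisc.injOn_boundary hs ht h'
  range_boundary := by
    have hsurj : Function.Surjective fun t : ℝ ↦ -t := fun y ↦ ⟨-y, neg_neg y⟩
    have : (fun t : ℝ ↦ circleMap 0 1 (2 * Real.pi * -t)) =
        (fun t : ℝ ↦ circleMap 0 1 (2 * Real.pi * t)) ∘ fun t : ℝ ↦ -t := rfl
    rw [this, hsurj.range_comp]
    exact JordanDomain.unitDisc.range_boundary
  mark := ![0, 1 / 2]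
  strictMono_mark := by
    refine Fin.strictMono_iff_lt_succ.2 fun k ↦ ?_
    fin_cases k
    simp
  mark_mem k := by fin_cases k <;> norm_num

/-- The carrier of the clockwise unit disc is the open unit ball. [folklore] -/
@[simp] theorem unitDiscCW_carrier : unitDiscCW.carrier = ball 0 1 := rfl

/-- The boundary loop of the clockwise unit disc. [folklore] -/
theorem unitDiscCW_boundary (t : ℝ) : unitDiscCW.boundary t = circleMap 0 1 (2 * Real.pi * -t) := rfl

/-- The first marked point of the clockwise unit disc is `a = 1`. [folklore] -/
@[simp] theorem unitDiscCW_pt_zero : unitDiscCW.pt 0 = 1 := by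
  simp [MarkedDomain.pt, unitDiscCW, circleMap]

/-- The second marked point of the clockwise unit disc is `b = -1`. [folklore] -/
@[simp] theorem unitDiscCW_pt_one : unitDiscCW.pt 1 = -1 := by
  have h : unitDiscCW.pt 1 = circleMap 0 1 (2 * Real.pi * -(1 / 2)) := rfl
  rw [h, circleMap_zero_one]
  have : ((2 * Real.pi * -(1 / 2) : ℝ) : ℂ) * I = -(Real.pi * I) := by push_cast; ring
  rw [this, Complex.exp_neg, Complex.exp_pi_mul_I]
  norm_num

/-- The two marked point sets coincide: `{1, -1}`. [folklore] -/
theorem pts_eq : ({unitDiscCW.pt 0, unitDiscCW.pt 1} : Set ℂ) =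
    {DobrushinDomain.unitDisc.pt 0, DobrushinDomain.unitDisc.pt 1} := by
  have h0 : DobrushinDomain.unitDisc.pt 0 = 1 := by
    simp [MarkedDomain.pt, DobrushinDomain.unitDisc, JordanDomain.unitDisc, circleMap]
  have h1 : DobrushinDomain.unitDisc.pt 1 = -1 := by
    have h : DobrushinDomain.unitDisc.pt 1 = circleMap 0 1 (2 * Real.pi * (1 / 2)) := rfl
    rw [h, circleMap_zero_one]
    have : ((2 * Real.pi * (1 / 2) : ℝ) : ℂ) * I = Real.pi * I := by push_cast; ring
    rw [this, Complex.exp_pi_mul_I]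
  rw [unitDiscCW_pt_zero, unitDiscCW_pt_one, h0, h1]

/-- The mark after the first one is `1/2`. [folklore] -/
theorem unitDiscCW_nextMark_zero : unitDiscCW.nextMark 0 = 1 / 2 := by
  simp [MarkedDomain.nextMark, unitDiscCW]

/-- The mark after the second one is `0 + 1 = 1` (cyclically). [folklore] -/
theorem unitDiscCW_nextMark_one : unitDiscCW.nextMark 1 = 1 := by
  simp [MarkedDomain.nextMark, unitDiscCW]

/-- The arc `(ab)` of the clockwise unit disc as a parametrised image. [folklore] -/
theorem unitDiscCW_arc_zero_eq_image : unitDiscCW.arc 0 =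
    (fun t : ℝ ↦ circleMap 0 1 (2 * Real.pi * -t)) '' Icc (0 : ℝ) (1 / 2) := by
  rw [MarkedDomain.arc, unitDiscCW_nextMark_zero]; rfl

/-- The arc `(ba)` of the clockwise unit disc as a parametrised image. [folklore] -/
theorem unitDiscCW_arc_one_eq_image : unitDiscCW.arc 1 =
    (fun t : ℝ ↦ circleMap 0 1 (2 * Real.pi * -t)) '' Icc (1 / 2 : ℝ) 1 := by
  rw [MarkedDomain.arc, unitDiscCW_nextMark_one]; rfl

/-- Points `exp(-2πit)` lie on the unit circle. [folklore] -/
theorem norm_circleMap_param (t : ℝ) : ‖circleMap 0 1 (2 * Real.pi * -t)‖ = 1 := by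
  simp

/-- **The arc `(ab)` of the clockwise unit disc is the lower closed half circle**, i.e. the arc
`(ba)` of the counter-clockwise unit disc. [folklore] -/
theorem unitDiscCW_arc_zero : unitDiscCW.arc 0 = DobrushinDomain.unitDisc.arc 1 := by
  ext w
  constructor
  · intro hw
    rw [unitDiscCW_arc_zero_eq_image] at hw
    obtain ⟨t, ht, rfl⟩ := hw
    refine mem_arc_one_of (norm_circleMap_param t) ?_
    dsimp only
    rw [circleMap_zero_one, Complex.exp_ofReal_mul_I_im,
      show 2 * Real.pi * -t = -(2 * Real.pi * t) by ring, Real.sin_neg, neg_nonpos]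
    exact Real.sin_nonneg_of_nonneg_of_le_pi (by nlinarith [Real.pi_pos, ht.1])
      (by nlinarith [Real.pi_pos, ht.2])
  · intro hw
    have hn := norm_eq_one_of_mem_arc hw
    have him := im_nonpos_of_mem_arc_one hw
    -- the conjugate lies on the upper half circle
    have hc : starRingEnd ℂ w ∈ DobrushinDomain.unitDisc.arc 0 :=
      mem_arc_zero_of (by rwa [Complex.norm_conj]) (by rw [Complex.conj_im]; linarith)
    rw [unitDisc_arc_zero] at hc
    obtain ⟨t, ht, hteq⟩ := hc
    rw [unitDiscCW_arc_zero_eq_image]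
    refine ⟨t, ht, ?_⟩
    dsimp only at hteq ⊢
    rw [show 2 * Real.pi * -t = -(2 * Real.pi * t) by ring, circleMap_neg, hteq]
    exact Complex.conj_conj w

/-- **The arc `(ba)` of the clockwise unit disc is the upper closed half circle**, i.e. the arc
`(ab)` of the counter-clockwise unit disc. [folklore] -/
theorem unitDiscCW_arc_one : unitDiscCW.arc 1 = DobrushinDomain.unitDisc.arc 0 := by
  ext w
  constructor
  · intro hw
    rw [unitDiscCW_arc_one_eq_image] at hw
    obtain ⟨t, ht, rfl⟩ := hw
    refine mem_arc_zero_of (norm_circleMap_param t) ?_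
    dsimp only
    rw [circleMap_zero_one, Complex.exp_ofReal_mul_I_im,
      show 2 * Real.pi * -t = -(2 * Real.pi * t) by ring, Real.sin_neg, ← Real.sin_sub_two_pi,
      neg_nonneg]
    exact Real.sin_nonpos_of_nonpos_of_neg_pi_le (by nlinarith [Real.pi_pos, ht.2])
      (by nlinarith [Real.pi_pos, ht.1])
  · intro hw
    have hn := norm_eq_one_of_mem_arc hw
    have him := im_nonneg_of_mem_arc_zero hw
    have hc : starRingEnd ℂ w ∈ DobrushinDomain.unitDisc.arc 1 :=
      mem_arc_one_of (by rwa [Complex.norm_conj]) (by rw [Complex.conj_im]; linarith)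
    rw [unitDisc_arc_one] at hc
    obtain ⟨t, ht, hteq⟩ := hc
    rw [unitDiscCW_arc_one_eq_image]
    refine ⟨t, ht, ?_⟩
    dsimp only at hteq ⊢
    rw [show 2 * Real.pi * -t = -(2 * Real.pi * t) by ring, circleMap_neg, hteq]
    exact Complex.conj_conj w

/-! ### The arc-swapped tilted data `discDataSwap δ = ⟨𝔻, δ, tiltLo δ, tiltUp δ⟩`

The data, their admissibility for `0 < δ < 1/2` and their start corner `((M, 0), 1)` are the landed
`Theorems/EdgeCoherence/Negative/CornerObservableRigidity.lean` (refuter of crux `EdgeCoherence`); here: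
the interface orientation and the discretisation-family property for the clockwise disc. -/

/-- The wired arc of the swapped data is the tilted lower arc. [folklore] -/
@[simp] theorem discDataSwap_arcA (δ : ℝ) : (discDataSwap δ).arcA = tiltLo δ := rfl

/-- The dual arc of the swapped data is the tilted upper arc. [folklore] -/
@[simp] theorem discDataSwap_arcB (δ : ℝ) : (discDataSwap δ).arcB = tiltUp δ := rfl

section Mesh

variable {δ : ℝ} (hδ : 0 < δ) (hδ' : δ < 1 / 2)
include hδ hδ'

/-- The chosen start corner of the swapped data is the corner `((M, 0), 1)`. [folklore] -/
theorem startCorner_discDataSwap :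
    startCorner (isZdAdmissible_discDataSwap hδ hδ') = ((![(abCol δ : ℤ), 0] : Site 2), (1 : Fin 4)) := by
  have hD := isZdAdmissible_discDataSwap hδ hδ'
  have h1 := isStartCorner_startCorner hD
  have h2 := isStartCorner_discDataSwap hδ hδ'
  exact (existsUnique_startCorner hD).unique ⟨h1.mem_zdArcA, h1.mem_zdArcB, h1.isOutEdge⟩
    ⟨h2.mem_zdArcA, h2.mem_zdArcB, h2.isOutEdge⟩

/-- The source edge of the start corner of the swapped data is `e_R`. [folklore] -/
theorem cSrc_startCorner_discDataSwap : cSrc (startCorner (isZdAdmissible_discDataSwap hδ hδ')) = eR δ := by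
  rw [startCorner_discDataSwap hδ hδ', cSrc, eR, Sym2.eq_swap]
  congr 1
  funext i; fin_cases i <;> simp [cornerUnit]

/-- **The native exploration of the swapped data starts at the midpoint of `e_R`**: the polyline's
initial point is `(δM, δ/2)`. [folklore] -/
theorem medialExplorationCurve_discDataSwap_zero (ω : Percolation.BondConfig (Site 2)) :
    medialExplorationCurve (discDataSwap δ) ω 0 = medialPoint δ (eR δ) := by
  have hD := isZdAdmissible_discDataSwap hδ hδ'
  rw [medialExplorationCurve, DiscreteDobrushin.medialExploration_map_eq hD,
    polyline_map_range_apply_zero]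
  show medialPoint δ (cSrc (cornerOrbit ((discDataSwap δ).bcBondConfig ω) (startCorner hD) 0)) = _
  rw [cornerOrbit_zero, cSrc_startCorner_discDataSwap hδ hδ']

omit hδ' in
/-- The midpoint of `e_R` is at least as close to `a = 1` as to `b = -1` (its real part `δM` is
nonnegative). [folklore] -/
theorem dist_medialPoint_eR_one_le :
    dist (medialPoint δ (eR δ)) 1 ≤ dist (medialPoint δ (eR δ)) (-1) := by
  have hre : 0 ≤ (medialPoint δ (eR δ)).re := by
    rw [medialPoint_eR_re]; positivity
  rw [dist_eq_norm, dist_eq_norm, sub_neg_eq_add]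
  have h1 : ‖medialPoint δ (eR δ) - 1‖ ^ 2 ≤ ‖medialPoint δ (eR δ) + 1‖ ^ 2 := by
    rw [Complex.sq_norm, Complex.sq_norm, Complex.normSq_apply, Complex.normSq_apply]
    simp only [Complex.sub_re, Complex.one_re, Complex.sub_im, Complex.one_im, sub_zero,
      Complex.add_re, Complex.add_im, add_zero]
    nlinarith
  exact le_of_sq_le_sq h1 (norm_nonneg _)

/-- **The interface of the swapped data in the clockwise disc is the class of the native exploration
polyline itself** (no time reversal by the endpoint rule `orientCurve`): it runs from `a = 1` to
`b = -1` with the wired arc (the tilted lower arc) on its LEFT. [folklore] -/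
theorem bondInterfaceIn_discDataSwap (ω : Percolation.BondConfig (Site 2)) :
    Percolation.bondInterfaceIn unitDiscCW (discDataSwap δ) ω =
      CurveClass.mk ⟨medialExplorationCurve (discDataSwap δ) ω⟩ := by
  rw [Percolation.bondInterfaceIn_apply, Percolation.orientCurve_of_le]
  rw [medialExplorationCurve_discDataSwap_zero hδ hδ', unitDiscCW_pt_zero, unitDiscCW_pt_one]
  exact dist_medialPoint_eR_one_le hδ

end Mesh

/-- **The swapped tilted data discretise the clockwise unit disc** (`ZdDiscretisationFamily`):
canonical vertex set, mesh `δ`, the tilted lower/upper arcs within Hausdorff distance `2δ` of the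
lower/upper half circles, discrete marked points within `3δ` of `{1, -1}`, admissible for
`δ ∈ (0, 1/2)`. [folklore] -/
theorem zdDiscretisationFamily_discDataSwap : ZdDiscretisationFamily unitDiscCW discDataSwap where
  Ω_eq _ := rfl
  δ_eq _ := rfl
  tendsto_arcA := by
    refine tendsto_zero_of_le (C := 2) fun δ hδ _ ↦ ?_
    rw [unitDiscCW_arc_zero]
    exact hausdorffEDist_tiltLo_le hδ
  tendsto_arcB := by
    refine tendsto_zero_of_le (C := 2) fun δ hδ _ ↦ ?_
    rw [unitDiscCW_arc_one]
    exact hausdorffEDist_tiltUp_le hδ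
  tendsto_zdABEdges := by
    refine tendsto_zero_of_le (C := 3) fun δ hδ hδ' ↦ ?_
    rw [zdABEdges_swap, pts_eq]
    exact hausdorffEDist_medialPoint_le hδ hδ'
  eventually_isZdAdmissible := by
    filter_upwards [Ioo_mem_nhdsGT (show (0 : ℝ) < 1 / 2 by norm_num)] with δ hδ
    exact isZdAdmissible_discDataSwap hδ.1 hδ.2

/-- **An oriented certified family exists**: a Dobrushin domain with a discretisation family whose
interfaces are, for all small positive meshes, the classes of the native exploration polylines
themselves. [folklore] -/
theorem exists_oriented_family :
    ∃ (D : DobrushinDomain) (E : ℝ → DiscreteDobrushin), ZdDiscretisationFamily D E ∧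
      ∀ᶠ δ in 𝓝[>] (0 : ℝ), (E δ).IsZdAdmissible ∧ ∀ ω,
        Percolation.bondInterfaceIn D (E δ) ω = CurveClass.mk ⟨medialExplorationCurve (E δ) ω⟩ := by
  refine ⟨unitDiscCW, discDataSwap, zdDiscretisationFamily_discDataSwap, ?_⟩
  filter_upwards [Ioo_mem_nhdsGT (show (0 : ℝ) < 1 / 2 by norm_num)] with δ hδ
  exact ⟨isZdAdmissible_discDataSwap hδ.1 hδ.2, bondInterfaceIn_discDataSwap hδ.1 hδ.2⟩

end OrientedDisc

end Summit.CriticalPhenomena.CardyFormulaZ2.Cruxes.CardyRigidity.CrossingMartingale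

end
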